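import Summits.BirchSwinnertonDyer.BirchSwinnertonDyer.Theorems.GenusKolyvaginAtTwoPowDvdShaCardAtTwoRTTwoPrimeSwapWeak
import HarnessLib

/-!
# Route `GenusKolyvaginAtTwo`, crux L_T `PowDvdShaCardAtTwoRT` (stmt-BirchSwinnertonDyer-23242), LINE 18 stub KS / (P52÷), the DROPS:
# the weak prime-swapping supply EXPORTING THE LEVEL — the avoiding class IS the ladder class `cls S` of an admissible all-good set `S`

Width seat `bsd-line-gk2-p4` g19 (cell `bsd-f1-sign2`), `--supports 23242 --as helper`.  Mathlib-only bookkeeping over gk2-p2's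
`…RTPrimeSwappingWeak` / `…RTTwoPrimeSwapWeak`; THEOREMS ONLY; no `sorry`; standard axioms.  BSD is NOT proved by any of this; neither is
the crux nor any stub.

WHY (gk2-p2 g18, STATUS 09:25Z, INTERFACE NOTE to LEAD/gk2-p4: «`exists_avoiding_of_weakSwapOracle_pow` exports only
`∃ z ∈ R, p^a ∣ ord z ∧ Disjoint` — (P52÷) needs the witness to BE `c_L(n)` of a deep depth-`r` LEVEL with `2^{M_r} ∥ P(n)` (export `S`,
`cls S`, `e S`)»).  In gk2-p2's proof the avoiding class is `cls S` for an admissible ALL-GOOD `S` produced by the loop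
`exists_good_not_mem_of_weakSwapOracle`; this file merely states the supply with that `S` EXPORTED, so the consumer reads the level
`n = ∏ S` (admissible: `Inv S`, i.e. `#S = r`, all primes deep, the minimum `M_r` attained), its datum's class `cls S` and exponent `e S`
directly:
* §1 **`exists_inv_avoiding_of_weakSwapOracle`** — same binders as `exists_avoiding_of_weakSwapOracle`, conclusion
  `∃ S, Inv S ∧ (∀ l ∈ S, good l) ∧ Disjoint ⟨cls S⟩ ⟨s⟩`; `exists_inv_avoiding_of_weakSwapOracle_pow` — socle form
  (`γ S = p^{e S − 1}·cls S`, `ord (cls S) = p^{e S}`, `a ≤ e S`);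
* §2 **`exists_inv_avoiding_of_twoPrimeReciprocity_weak`** — the same from Kolyvagin's two-prime engine with TWO prescriptions
  (`weakSwapOracle_of_twoPrimeReciprocity`): the binders of gk2-p2's `exists_avoiding_of_twoPrimeReciprocity_weak` verbatim, the level exported.
The Čebotarev input `hceb` of §2 is discharged in datum currency by this seat's `RelaxedCount.exists_deep_kolyvaginPrime_fullOrder_pair_of_data`
(`…RTDropChebotarevPair`).  Namespace `…Theorems.GenusExact.PlusDescent`.  Closes nothing.  BSD is NOT proved by any of this.

References: [McCallumLMS1991] §5 Prop. 5.2 (statement p. 308; proof pp. 308–310), §4 Lemma 4.6; [Kolyvagin1991MathAnn] Thm. 2.1.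
-/

set_option autoImplicit false
-- `Summit.<P>.<Sub>` repeats `BirchSwinnertonDyer` by the tree's layout convention (D-0017)
set_option linter.dupNamespace false

namespace Summit.BirchSwinnertonDyer.BirchSwinnertonDyer.Theorems.GenusExact.PlusDescent

open AddSubgroup Finset

/-! ## §1 The weak supply with the admissible set exported -/

section Export

variable {V : Type*} [AddCommGroup V]

/-- **One rung of McCallum's supply from the weak swap oracle, LEVEL EXPORTED.**  Binders exactly as in gk2-p2's
`exists_avoiding_of_weakSwapOracle`; conclusion: an ADMISSIBLE all-good set `S` (`Inv S`: `#S = r`, the minimum attained, every prime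
admissible/deep) whose ladder class `cls S` itself avoids `⟨s⟩` — so the consumer ((P52÷) / (KS)) receives the level `n = ∏ S`, not just
an anonymous class. [cite: McCallumLMS1991, §5 Prop. 5.2] -/
theorem exists_inv_avoiding_of_weakSwapOracle {p : ℕ} (hp : p.Prime) {M : ℕ} (hV : ∀ v : V, p ^ M • v = 0)
    (R : AddSubgroup V) [Finite R] (A : ℕ → AddSubgroup V) (good : ℕ → Prop) (r : ℕ) (Inv : Finset ℕ → Prop)
    (hcardS : ∀ S, Inv S → S.card = r)
    (hK : ∀ l, good l → ∀ s : Finset V, (↑s : Set V) ⊆ R →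
      (A l).relIndex (AddSubgroup.closure (↑s : Set V) ⊓ AddSubgroup.torsionBy V (p : ℤ)) ∣ p)
    (S₀ : Finset ℕ) (hS₀ : Inv S₀)
    (cls γ : Finset ℕ → V) {a : ℕ}
    (hcls : ∀ S, Inv S → (∀ l ∈ S, good l) →
      cls S ∈ R ∧ p ^ a ∣ addOrderOf (cls S) ∧ (∀ l ∈ S, cls S ∈ A l) ∧
      γ S ∈ AddSubgroup.zmultiples (cls S) ∧ γ S ≠ 0 ∧ p • γ S = 0)
    (oracle : ∀ S, Inv S → ∀ l₀ ∈ S, ∃ l', l' ∉ S ∧ good l' ∧ Inv (insert l' (S.erase l₀)) ∧ γ S ∉ A l')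
    (s : Finset V) (hs : (↑s : Set V) ⊆ R) (hsr : s.card ≤ r) :
    ∃ S : Finset ℕ, Inv S ∧ (∀ l ∈ S, good l) ∧
      Disjoint (AddSubgroup.zmultiples (cls S)) (AddSubgroup.closure (↑s : Set V)) := by
  classical
  -- (gk2-p2's proof of `exists_avoiding_of_weakSwapOracle`, keeping the set `S`)
  set C : AddSubgroup V := AddSubgroup.closure (↑s : Set V) with hC
  have hCR : C ≤ R := (AddSubgroup.closure_le R).mpr hs
  haveI : Finite C := Finite.of_injective _ (AddSubgroup.inclusion_injective hCR)
  obtain ⟨d, hd, hcard⟩ := exists_natCard_closure_inf_torsionBy_eq_pow (V := V) hp R s hs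
  have hγ : ∀ S, Inv S → (∀ l ∈ S, good l) → γ S ≠ 0 ∧ p • γ S = 0 ∧ ∀ l ∈ S, γ S ∈ A l := by
    intro S hS hgood
    obtain ⟨-, -, hA, hγz, hγ0, hγp⟩ := hcls S hS hgood
    exact ⟨hγ0, hγp, fun l hl ↦ AddSubgroup.zmultiples_le_of_mem (hA l hl) hγz⟩
  obtain ⟨S, hS, hgood, hγC⟩ := exists_good_not_mem_of_weakSwapOracle hp C hcard (hd.trans hsr) A good Inv hcardS
    (fun l hl ↦ hK l hl s hs) γ hγ S₀ hS₀ oracle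
  obtain ⟨-, -, -, hγz, -, hγp⟩ := hcls S hS hgood
  exact ⟨S, hS, hgood, disjoint_zmultiples_of_socle_not_mem hp hV C hγz hγp hγC⟩

/-- **Level-exported supply, socle form**: as `exists_inv_avoiding_of_weakSwapOracle` with the detected class given as
`γ S = p^{e S − 1} · cls S`, `ord (cls S) = p^{e S}`, `a ≤ e S`, `1 ≤ a` (the binders of gk2-p2's `exists_avoiding_of_weakSwapOracle_pow`).
The consumer reads off `S` (admissible, all good), `cls S` of order `p^{e S}` avoiding `⟨s⟩`. [cite: McCallumLMS1991, §5 Prop. 5.2, §4 Lemma 4.6] -/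
theorem exists_inv_avoiding_of_weakSwapOracle_pow {p : ℕ} (hp : p.Prime) {M : ℕ} (hV : ∀ v : V, p ^ M • v = 0)
    (R : AddSubgroup V) [Finite R] (A : ℕ → AddSubgroup V) (good : ℕ → Prop) (r : ℕ) (Inv : Finset ℕ → Prop)
    (hcardS : ∀ S, Inv S → S.card = r)
    (hK : ∀ l, good l → ∀ s : Finset V, (↑s : Set V) ⊆ R →
      (A l).relIndex (AddSubgroup.closure (↑s : Set V) ⊓ AddSubgroup.torsionBy V (p : ℤ)) ∣ p)
    (S₀ : Finset ℕ) (hS₀ : Inv S₀)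
    (cls : Finset ℕ → V) (e : Finset ℕ → ℕ) {a : ℕ} (ha : 1 ≤ a)
    (hcls : ∀ S, Inv S → (∀ l ∈ S, good l) →
      cls S ∈ R ∧ addOrderOf (cls S) = p ^ e S ∧ a ≤ e S ∧ ∀ l ∈ S, cls S ∈ A l)
    (oracle : ∀ S, Inv S → ∀ l₀ ∈ S,
      ∃ l', l' ∉ S ∧ good l' ∧ Inv (insert l' (S.erase l₀)) ∧ p ^ (e S - 1) • cls S ∉ A l')
    (s : Finset V) (hs : (↑s : Set V) ⊆ R) (hsr : s.card ≤ r) :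
    ∃ S : Finset ℕ, Inv S ∧ (∀ l ∈ S, good l) ∧
      Disjoint (AddSubgroup.zmultiples (cls S)) (AddSubgroup.closure (↑s : Set V)) := by
  refine exists_inv_avoiding_of_weakSwapOracle hp hV R A good r Inv hcardS hK S₀ hS₀ cls
    (fun S ↦ p ^ (e S - 1) • cls S) (a := a) (fun S hS hgood ↦ ?_) oracle s hs hsr
  obtain ⟨hR, hord, hae, hA⟩ := hcls S hS hgood
  obtain ⟨h0, hp0, hmem⟩ := pow_pred_nsmul_socle (le_trans ha hae) hord hp
  exact ⟨hR, hord ▸ pow_dvd_pow p hae, hA, hmem, h0, hp0⟩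

/-! ## §2 … from Kolyvagin's two-prime engine with two prescriptions -/

/-- **ONE RUNG OF THE SUPPLY from the two-prime engine, LEVEL EXPORTED.**  Binders exactly as in gk2-p2's
`exists_avoiding_of_twoPrimeReciprocity_weak` (the weak oracle is manufactured by `weakSwapOracle_of_twoPrimeReciprocity` from: pair
Čebotarev `hceb` — discharged in datum currency by `RelaxedCount.exists_deep_kolyvaginPrime_fullOrder_pair_of_data` —, the two-term
reciprocity `hrec` under its guard, `hloc`, `hmin`, `hM`, the invariant dictionary, and `hγA`); conclusion: an admissible all-good `S` whose
ladder class `cls S` avoids `⟨s⟩`. [cite: McCallumLMS1991, §5 Prop. 5.2] [cite: Kolyvagin1991MathAnn, Thm. 2.1] -/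
theorem exists_inv_avoiding_of_twoPrimeReciprocity_weak {p : ℕ} (hp : p.Prime) {M₀ : ℕ} (hV : ∀ v : V, p ^ M₀ • v = 0)
    (R : AddSubgroup V) [Finite R] (A : ℕ → AddSubgroup V) (good adm : ℕ → Prop) (r : ℕ) (Inv : Finset ℕ → Prop)
    (m : Finset ℕ → ℕ) (dl : Finset ℕ → ℕ → ℕ) (M Mr : ℕ)
    (hgood : ∀ l, adm l → good l)
    (hInv_out : ∀ S, Inv S → S.card = r ∧ (∀ l ∈ S, adm l) ∧ m S = Mr)
    (hInv_in : ∀ S, S.card = r → (∀ l ∈ S, adm l) → m S = Mr → Inv S)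
    (hmin : ∀ S, S.card = r → (∀ l ∈ S, adm l) → Mr ≤ m S)
    (hloc : ∀ S l, (∀ l' ∈ S, adm l') → adm l → l ∉ S → m S ≤ dl S l)
    (hceb : ∀ S, Inv S → ∀ l₀ ∈ S, ∃ l', l' ∉ S ∧ adm l' ∧
      dl (S.erase l₀) l' = m (S.erase l₀) ∧ dl S l' = m S)
    (hrec : ∀ S, Inv S → ∀ l₀ ∈ S, ∀ l', l' ∉ S → adm l' →
      dl (S.erase l₀) l' + dl S l' + 2 ≤ M →
      dl (S.erase l₀) l' + dl S l' = dl (S.erase l₀) l₀ + dl (insert l' (S.erase l₀)) l₀)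
    (hM : ∀ S, Inv S → ∀ l₀ ∈ S, m (S.erase l₀) + Mr + 2 ≤ M)
    (hK : ∀ l, good l → ∀ s : Finset V, (↑s : Set V) ⊆ R →
      (A l).relIndex (AddSubgroup.closure (↑s : Set V) ⊓ AddSubgroup.torsionBy V (p : ℤ)) ∣ p)
    (S₀ : Finset ℕ) (hS₀ : Inv S₀)
    (cls γ : Finset ℕ → V) {a : ℕ}
    (hcls : ∀ S, Inv S → (∀ l ∈ S, good l) →
      cls S ∈ R ∧ p ^ a ∣ addOrderOf (cls S) ∧ (∀ l ∈ S, cls S ∈ A l) ∧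
      γ S ∈ AddSubgroup.zmultiples (cls S) ∧ γ S ≠ 0 ∧ p • γ S = 0)
    (hγA : ∀ S l, Inv S → adm l → l ∉ S → dl S l = m S → γ S ∉ A l)
    (s : Finset V) (hs : (↑s : Set V) ⊆ R) (hsr : s.card ≤ r) :
    ∃ S : Finset ℕ, Inv S ∧ (∀ l ∈ S, good l) ∧
      Disjoint (AddSubgroup.zmultiples (cls S)) (AddSubgroup.closure (↑s : Set V)) :=
  exists_inv_avoiding_of_weakSwapOracle hp hV R A good r Inv (fun S hS ↦ (hInv_out S hS).1) hK S₀ hS₀ cls γ hcls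
    (weakSwapOracle_of_twoPrimeReciprocity A good adm Inv m dl M Mr r γ hgood hInv_out hInv_in hmin hloc hceb hrec hM hγA)
    s hs hsr

end Export

end Summit.BirchSwinnertonDyer.BirchSwinnertonDyer.Theorems.GenusExact.PlusDescent
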